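import Mathlib
import Summits.MatrixMultiplication.MatrixMultiplication.Theses.CondensationDistance

/-!
# `ShortCondensation` is false modulo a super-quadratic TOP (`stub_topKill` of the top-rigidity ladder)

The kill form of the strategists' top-`t` invariant (crux workfile `Cruxes/ShortCondensation/TopRigiditySketch.lean`,
`stub_topKill`, census §0c F3), proved sorry-free as a negative lemma modulo the hypothesis it names.

For a listing `f : Fin l → Finset (Fin (n + m'))` let `topCount n m' l f t` be the number of DISTINCT listed sets of
height `≥ n - t` (height = number of non-identity columns = size of the minor).  `SuperQuadraticTop` (`H_top`) says:
for some `δ > 0` and arbitrarily large `t` there is `N > (t+2)^(2+δ)` such that every valid derivation of the columns of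
`X` inside ANY `J(n + m', n)` with `n ≥ t + 2`, `m' ≥ n` lists at least `N` distinct sets in its top `t + 1` levels
(machine data, `TopLevelsCompute.md`: the top three levels always hold `≥ 14 = 1 + 4 + 9` sets — Dodgson-tight — at
every computed ambient size and auxiliary width).  Then `ShortCondensation` fails: run it with `ε := δ` at `n := t + 2`.

* `topCount`, `topCount_le_length`;
* `SuperQuadraticTop` (`H_top`);
* `ShortCondensation_false_of_SuperQuadraticTop : SuperQuadraticTop → ¬ ShortCondensation`.

No refutation is claimed: `H_top` is not proved here (it is the `t → ∞` content of the top-rigidity ladder TR(t)). [folklore]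
-/

set_option linter.dupNamespace false

namespace Summit.MatrixMultiplication.MatrixMultiplication.Theorems.ShortCondensation

open Summit.MatrixMultiplication.MatrixMultiplication.Theses.CondensationDistance

/-- `topCount n m' l f t` = number of distinct listed sets of height `≥ n - t` (height of `J` = number of its
elements `≥ n`, i.e. non-identity columns; the top `t + 1` levels, the target level `n` included). -/
def topCount (n m' l : ℕ) (f : Fin l → Finset (Fin (n + m'))) (t : ℕ) : ℕ :=
  ((Finset.univ.image f).filter fun J => n - t ≤ (J.filter fun x : Fin (n + m') => n ≤ x.val).card).card

/-- The top count never exceeds the length of the listing. -/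
theorem topCount_le_length (n m' l : ℕ) (f : Fin l → Finset (Fin (n + m'))) (t : ℕ) : topCount n m' l f t ≤ l := by
  classical
  unfold topCount
  calc ((Finset.univ.image f).filter fun J => n - t ≤ (J.filter fun x : Fin (n + m') => n ≤ x.val).card).card
      ≤ (Finset.univ.image f).card := Finset.card_filter_le _ _
    _ ≤ (Finset.univ : Finset (Fin l)).card := Finset.card_image_le
    _ = l := by rw [Finset.card_univ, Fintype.card_fin]

/-- **`H_top`, a super-quadratic top infinitely often.**  There is `δ > 0` such that for every `t₀` some `t ≥ t₀`
and `N` with `(t+2)^(2+δ) < N` have: every listing in any `J(n + m', n)`, `t + 2 ≤ n ≤ m'`, that is valid for the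
route's octahedron rule (five mates in the radius-1 ball or listed earlier) and lists the columns of `X` has
`topCount ≥ N`.  Equivalently `c_t(∞, ∞) > (t+2)^(2+δ)` infinitely often for the top-`t` relaxation of
`TopLevelsCompute.md`; Dodgson shows `c_t ≤ Σ_{j ≤ t} (j+1)²`, and TR(t) conjectures equality.
[topic: Computability/AlgebraicComplexity — octahedral (Plücker-exchange) derivations of the determinant] -/
def SuperQuadraticTop : Prop :=
  ∃ δ : ℝ, 0 < δ ∧ ∀ t₀ : ℕ, ∃ t ≥ t₀, ∃ N : ℕ, ((t : ℝ) + 2) ^ (2 + δ) < (N : ℝ) ∧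
    ∀ n m' : ℕ, t + 2 ≤ n → n ≤ m' → ∀ (l : ℕ) (f : Fin l → Finset (Fin (n + m'))),
      (∀ i : Fin l, ∃ p ∈ f i, ∃ q ∈ f i, p ≠ q ∧ ∃ u ∉ f i, ∃ v ∉ f i, u ≠ v ∧
        ∀ J ∈ [insert u ((f i).erase p), insert v ((f i).erase p), insert u ((f i).erase q),
          insert v ((f i).erase q), insert u (insert v (((f i).erase p).erase q))],
          (J.card = n ∧ (J.filter fun x : Fin (n + m') => n ≤ x.val).card ≤ 1) ∨ ∃ j : Fin l, j < i ∧ f j = J) →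
      (∃ i : Fin l, f i = Finset.univ.filter fun x : Fin (n + m') => n ≤ x.val ∧ x.val < 2 * n) →
      N ≤ topCount n m' l f t

/-- **Kill form of the top-rigidity ladder** (`stub_topKill`): `H_top → ¬ ShortCondensation`.  Run
`ShortCondensation` with `ε := δ`, obtaining `c, n₀`; pick `t ≥ n₀` and `N` from `H_top`; at `n := t + 2 ≥ n₀` the short
listing has length `l ≤ (t+2)^(2+δ) < N ≤ topCount ≤ l`. [folklore] -/
theorem ShortCondensation_false_of_SuperQuadraticTop (H : SuperQuadraticTop) : ¬ ShortCondensation := by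
  intro hX
  obtain ⟨δ, hδ, hH⟩ := H
  obtain ⟨c, n₀, hc⟩ := hX δ hδ
  obtain ⟨t, ht, N, hN, htop⟩ := hH n₀
  obtain ⟨m', hnm, -, l, f, hl, hvalid, htarget⟩ := hc (t + 2) (by omega)
  have key : N ≤ topCount (t + 2) m' l f t := htop (t + 2) m' le_rfl hnm l f hvalid htarget
  have h1 : (N : ℝ) ≤ (l : ℝ) := by exact_mod_cast key.trans (topCount_le_length (t + 2) m' l f t)
  have h2 : ((t + 2 : ℕ) : ℝ) = (t : ℝ) + 2 := by push_cast; ring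
  rw [h2] at hl
  linarith

end Summit.MatrixMultiplication.MatrixMultiplication.Theorems.ShortCondensation
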